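import Literature.MathematicalPhysics.QuantumFieldTheory.Balaban1983to89.B9GradViaDivLettersSmoothTerms
import Literature.MathematicalPhysics.QuantumFieldTheory.Balaban1983to89.B9SmoothHolderClassT
import Literature.MathematicalPhysics.QuantumFieldTheory.Balaban1983to89.B9TaxiTransportLadder

/-!
# `Balaban1983to89.B9GradViaDivLettersTransported` — THE KINEMATIC LETTER `J_μ(U)` BETWEEN THE TRANSPORTED SMOOTH-PARTITION HÖLDER CLASSES
# `bHZT g_S ε p → bHZKT g_B ε p` WITHOUT A SMALL-GAUGE BINDER: the transport variation of the flat letter is replaced by the LADDER DEFECT of the two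
# transporter tables (`B9TaxiTransportLadder`), a gauge-INVARIANT quantity bounded by the plaquette variables of (3.35)

T. Bałaban, *Propagators for lattice gauge theories in a background field*, Commun. Math. Phys. **99** (1985) 389–434
[`Balaban1985BackgroundPropagators`, "B9"]; [4] = T. Bałaban, *Propagators and renormalization transformations for lattice gauge
theories. II*, Commun. Math. Phys. **96** (1984) 223–250 [`Balaban1984PropagatorsII`].

statement-level skeleton of published theorems with citation tags; proofs where landed; nothing here is a claim about the
Yang–Mills mass gap

THE PRINTED LOCI.  [B9] (3.3) p. 390 (covariant derivative), (3.40) p. 397 (transported Hölder quotients along *"a shortest contour"*), p. 398 L19 (*"All these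
inequalities are invariant with respect to gauge transformations of U"*), (3.35) p. 396 (plaquette regularity), (3.43)–(3.45) p. 398; [4] (2.51)–(2.54) p. 232, (2.137) p. 247.

WHY THIS FILE (cell `pub-ymgap`, node N06, seat dag-n06-l g21; second half of OPTION (2) of the knit's WORD-TZ, INBOX l.40854: *«transported classes bHZᵀ(U)
+ the transported J-letter»*).  g20's `B9GradViaDivLettersSmooth.hasMaj_JcoKH_smooth` maps the FLAT classes and pays for the transporter `R(U_μ(b₋))` inside
`J_μ` with the small-gauge binder `hΘ : t^{−ε}‖U_μ(s) − U_μ(s′)‖ ≤ ϑ` — gauge-VARIANT, not feedable from the certificate's (3.35)∕(3.36) classes.  In the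
TRANSPORTED classes the same computation produces, at a near bond pair `((s,μ),(s′,μ))`, the vector `Λ(z) − R(W)Λ(z′)` (`z = s + e_μ`, `z′ = s′ + e_μ`,
`W := U_μ(s)⁻¹·g_B(s,s′)·U_μ(s′)`), which splits into the SITE class's transported difference `Λ(z) − R(g_S(z,z′))Λ(z′)` plus the LADDER DEFECT
`(R(g_S(z,z′)) − R(W))Λ(z′)` — for def-Y's taxicab tables the holonomy of the strip between `Γ_{s,s′}` and `Γ_{z,z′}`, bounded by `B9TaxiTransportLadder.ladder_R_le`
through the plaquette variables `U(∂p)` (gauge-INVARIANT; (3.35) makes them `O(Mα₀L^{−2j})`):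
* §1 `PairT` (the transported near-pair size of the site class), `bHZT_loc_eq`, `assembleK_JcoKH`, `trDif_eq_zero_of_fibres`, ★ `weight_mul_abs_trDif_le` (one transported
  site-pair term: `≤ (1 + cR39)·(PairT + L·Wscl p y′·SupZ)` — near pairs based in `Δ̃(y′)` at either end are terms of `PairT` (at the far end through the vanishing
  of `Λ` there), far pairs have weight `≤ L·Wscl`), the constant `CJT`;
* §2 ★★★ `hasMaj_JcoKH_transported` — `HasMaj (bHZT i b g_S hε0 hε1 hεp) (bHZKT i b g_B hε0 hε1 hεp) (J_μ(U₁)) (cR39·CJT·e^{δ·rZ}·e^{−δd})` for ABSTRACT tables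
  `g_S, g_B` under: contracting links `hU`, `R(g_S)` non-expanding (`hgS`), and the LADDER-DEFECT binder `hlad : ‖R(U_μ(s)⁻¹g_B(s,s′)U_μ(s′))Y − R(g_S(z,z′))Y‖ ≤
  ϑ_L·t(s,s′)·‖Y‖` on admissible pairs (`t` = def-Y's pair parameter `tpar`), plus g20's displayed enlargement radius `hN`; NO `hΘ`;
* §3 ★★ `hasMaj_JcoKH_taxi` — at def-Y's TAXICAB tables (`g_S := parSY`-table, `g_B := parBY`-table of `U₁`) the ladder binder is DISCHARGED by `ladder_R_le` from a
  displayed PLAQUETTE binder `hF : ‖U(∂p_{y;μ,ν}) − 1‖ ≤ ϑ_F·(L^{lev y})⁻¹` (gauge-invariant, the content of (3.35) in any gauge) — constant `ϑ_L := 2·d·L²·ϑ_F`.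
HONEST SCOPE.  Finite-dimensional bookkeeping; `hF` and `hN` are displayed binders (inhabitable: (3.35), LAYER B); nothing of [B9]∕[4] asserted; no pin, no certificate
edit; COUNT-NEUTRAL; N06 NOT discharged; nothing continuum, nothing about the mass gap.  Cell `pub-ymgap` (HUMAN RULING D-0062), Track A node N06 [B9], seat
`pub-ymgap-dag-n06-l` (g21), 2026-08-28.
-/

noncomputable section

namespace Literature.MathematicalPhysics.QuantumFieldTheory.Balaban1983to89.B9GradViaDivLettersTransported

open B4TorusKernel.MultiPeriod (torusSupNorm)
open B6MultiLevelTorusOperator (one_le_N0)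
open B6Geom246MultiLevelTorus (geomT)
open B6GlobalChartV1 (PV blkV1 boxEquiv)
open B6Ineq2142KLevelV1 (β lvl)
open B6KLevelCensusIndexV1 (KIdx Adm tpar tpar_nonneg tpar_le_one)
open B6Prop22KLevelTorusCensusEta (nKT one_le_nKT one_le_torusSupNorm_sub)
open B9GeoNormsKLevelV1 (geo9K)
open B9Thm34Ext (toB6)
open B9Eq39Adjoint (R)
open B9Thm39ReadingCoords (cR39 cR39_nonneg coordBound39 basisBound39 abs_repr_le norm_sum_smul_basis_le)
open B11SectG (BlockNorm HasMaj)
open B11SectGGlobal (Size)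
open B11SectGGlobalSizes
open B11SectGSmoothCutT (Size.ofPairsT ofPairsT_term_le ofPairsT_sz_le)
open B9CoReadingCoords (XBK assembleK)
open B9CoReadingCoordsS (XSK sIK)
open B9GradViaDivLettersAtPins (JcoKH JcoKH_apply Jb_apply rJ)
open B9GradViaDivLettersAtPinsHolderPairs (torusSupNorm_chartY_sub tpar_eq JcoKH_apply_of_dir_ne shift_injective' norm_assembleK_le)
open B9MultiscaleSmoothPartitionY (scl scl_pos NearY levY_window levY_window_of_nearY)
open B9MultiscaleSmoothPartitionYLip (CLip)
open B9SmoothHolderClassS (Wscl Wscl_nonneg Wscl_mono NearPair wEta wEta_nonneg)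
open B9SmoothHolderClassK (srcY NearPairK wEtaK wEtaK_nonneg src_ne_of_nearPairK)
open B9SmoothHolderClassT (trDif trDif_apply bHZT bHZT_loc bHZT_isLoc_iff bHZKT bHZKT_loc)
open B9TaxiTransportLadder (ladder_R_le plaqV supDist_shift norm_R_parTaxiV_le)
open B16Txt357ThirdOrderNonAbelian (norm_R_le)
open B9GradViaDivLettersSmoothTerms
open LatticeFieldCalculus (supDist)
open Node00 (SiteY FBondY IBondY CfgY toKT levY parTaxiV)
open Node00.OpsYNablaBridge (chartY)

variable {𝔸 : Type} [NormedRing 𝔸] [NormedAlgebra ℂ 𝔸] [CompleteSpace 𝔸]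
variable {d ℓ : ℕ} {hd : 1 ≤ d + 1} {hL : Odd (ℓ + 1) ∧ 1 < ℓ + 1} {b₀ b₁ : ℝ}
variable (i : KIdx d ℓ hd hL b₀ b₁)
variable {κ : Type} [Fintype κ]

/-! ## §1 The transported pair size of the site class and the one-pair term -/

section Terms

variable [Fintype (geo9K i).Site]
variable (b : Module.Basis κ ℝ 𝔸) [FiniteDimensional ℝ 𝔸] (B : B9.Backgrounds) (cfg : B.Cfg → CfgY 𝔸 i) (gS : SiteY i → SiteY i → 𝔸ˣ)
variable {R₀ : ℝ} {H₀ : Prop} {ε p : ℝ}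

open Classical in
/-- the TRANSPORTED near-pair part of a site vector based in `Δ̃(y′)` (the pair size of `bHZT g_S ε p`). [cite: Balaban1985BackgroundPropagators, (3.40) p.397 + (3.44) p.398, dictionary] -/
def PairT (ε : ℝ) (y' : IBondY i) (lam : XSK κ i → ℝ) : ℝ :=
  (Size.ofPairsT (toB6 (geo9K i) R₀ H₀) (fun (q : XSK κ i) (y : IBondY i) => NearY i y q.1) (NearPair i) (wEta i ε) (wEta_nonneg i ε) (trDif b gS)).sz y' lam

variable {i b B cfg gS}

omit [CompleteSpace 𝔸] [FiniteDimensional ℝ 𝔸] in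
/-- `0 ≤ PairT`. [cite: Balaban1985BackgroundPropagators, (3.40) p.397, bookkeeping] -/
theorem PairT_nonneg (y' : IBondY i) (lam : XSK κ i → ℝ) : 0 ≤ PairT (R₀ := R₀) (H₀ := H₀) i b gS ε y' lam := Size.nonneg _ _ _

omit [CompleteSpace 𝔸] [FiniteDimensional ℝ 𝔸] in
/-- the local size of the transported source class unfolded: `loc_{y′} λ = Wscl p y′·SupZ + PairT`. [cite: Balaban1985BackgroundPropagators, (3.44) p.398, bookkeeping] -/
theorem bHZT_loc_eq (hε0 : 0 ≤ ε) (hε1 : ε ≤ 1) (hεp : ε ≤ p) (y' : IBondY i) (lam : XSK κ i → ℝ) :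
    (bHZT (κ := κ) i b gS (R := R₀) (H := H₀) hε0 hε1 hεp).loc y' lam =
      Wscl i p y' * SupZ (R := R₀) (H := H₀) i y' lam + PairT (R₀ := R₀) (H₀ := H₀) i b gS ε y' lam := by
  unfold SupZ PairT
  exact bHZT_loc i b gS hε0 hε1 hεp y' lam

omit [Fintype (geo9K i).Site] [FiniteDimensional ℝ 𝔸] in
/-- re-assembling a slice of `J_μλ` gives `J_μ` of the re-assembled slice: `Ψ_J = J_μ(U)Λ`. [cite: Balaban1985BackgroundPropagators, (3.3) p.390, dictionary] -/
theorem assembleK_JcoKH (μ : Fin (d + 1)) (U₁ : B.Cfg) (ν : Fin (d + 1)) (c' : κ) (lam : XSK κ i → ℝ) (x : FBondY i) :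
    assembleK b ν c' (JcoKH i b B cfg μ U₁ lam) x = B9GradViaDivLettersAtPins.Jb i (cfg U₁) μ (assembleK b ν c' lam) x := by
  simp only [assembleK, JcoKH_apply]
  exact b.sum_repr _

omit [CompleteSpace 𝔸] [FiniteDimensional ℝ 𝔸] in
/-- the transported difference vanishes when the vector vanishes on both colour fibres. [cite: Balaban1985BackgroundPropagators, (3.40) p.397, bookkeeping] -/
theorem trDif_eq_zero_of_fibres {S D : Type} (g : S → S → 𝔸ˣ) (q q' : S × D × κ × κ) {F : S × D × κ × κ → ℝ}
    (h : ∀ a, F (q.1, q.2.1, a, q.2.2.2) = 0) (h' : ∀ a, F (q'.1, q.2.1, a, q.2.2.2) = 0) : trDif b g q q' F = 0 := by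
  have h1 : assembleK b q.2.1 q.2.2.2 F q.1 = 0 := Finset.sum_eq_zero fun a _ => by rw [h a, zero_smul]
  have h2 : assembleK b q.2.1 q.2.2.2 F q'.1 = 0 := Finset.sum_eq_zero fun a _ => by rw [h' a, zero_smul]
  rw [trDif_apply, h1, h2, B9Eq39Adjoint.R_zero, sub_zero, map_zero, Finsupp.zero_apply]

omit [CompleteSpace 𝔸] [Fintype (geo9K i).Site] [FiniteDimensional ℝ 𝔸] in
/-- the transported difference of the re-assembled slice, expanded in the frame: `Λ(z) − R(g z z′)Λ(z′) = Σ_a (trDif b g (z,ν,a,c′) (z′,ν,a,c′) λ) • b_a`.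
[cite: Balaban1985BackgroundPropagators, (3.40) p.397, dictionary] -/
theorem assembleK_sub_R_eq_sum (ν : Fin (d + 1)) (c' : κ) (lam : XSK κ i → ℝ) (z z' : SiteY i) :
    assembleK b ν c' lam z - R (gS z z') (assembleK b ν c' lam z') = ∑ a, trDif b gS (z, ν, a, c') (z', ν, a, c') lam • b a := by
  conv_lhs => rw [← b.sum_repr (assembleK b ν c' lam z - R (gS z z') (assembleK b ν c' lam z'))]
  rfl

/-- the constant of the letter: sup part `L^{4p}`, pair part `(1 + cR39)·(L + 1)`, ladder part `ϑ_L·L³`. [cite: Balaban1985BackgroundPropagators, (3.43)–(3.45) p.398, bookkeeping] -/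
def CJT (b : Module.Basis κ ℝ 𝔸) (ℓ : ℕ) (p ϑL : ℝ) : ℝ :=
  (((ℓ + 1 : ℕ) : ℝ)) ^ ((4 : ℝ) * p) + (1 + cR39 b) * (((ℓ + 1 : ℕ) : ℝ) + 1) + ϑL * (((ℓ + 1 : ℕ) : ℝ)) ^ 3

omit [CompleteSpace 𝔸] in
/-- `0 ≤ CJT` for `ϑ_L ≥ 0`. [cite: Balaban1985BackgroundPropagators, (3.45) p.398, bookkeeping] -/
theorem CJT_nonneg {ϑL : ℝ} (hϑ : 0 ≤ ϑL) : 0 ≤ CJT b ℓ p ϑL := by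
  have := cR39_nonneg b
  unfold CJT; positivity

omit [CompleteSpace 𝔸] in
/-- ★ **ONE TRANSPORTED SITE PAIR TERM**: for distinct charted sites `z, z′`, slots `s`, a vector vanishing off `Δ̃(y′)` and a non-expanding transporter table,
`wEta ε·|trDif b g_S (z,s) (z′,s) λ| ≤ (1 + cR39)·(PairT + L·Wscl p y′·SupZ)` — a near pair based at `z ∈ Δ̃(y′)` is a term of `PairT`; a near pair based at
`z′ ∈ Δ̃(y′)` with `z ∉ Δ̃(y′)` has `Λ(z) = 0`, so its coordinates are read through the `z′`-based terms of `PairT` (× `cR39`); far pairs have weight `≤ L·Wscl p y′`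
and `|trDif| ≤ (1 + cR39)·SupZ`. [cite: Balaban1985BackgroundPropagators, (3.40) p.397 + (3.44) p.398; Balaban1984PropagatorsII, (2.137) p.247] -/
theorem weight_mul_abs_trDif_le (hε0 : 0 ≤ ε) (hε1 : ε ≤ 1) (hεp : ε ≤ p) (hgS : ∀ (z z' : SiteY i) (Y : 𝔸), ‖R (gS z z') Y‖ ≤ ‖Y‖)
    {y' : IBondY i} {lam : XSK κ i → ℝ} (hloc : ∀ q : XSK κ i, ¬ NearY i y' q.1 → lam q = 0) {z z' : SiteY i} (hne : z.1 ≠ z'.1)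
    (s : Fin (d + 1) × κ × κ) :
    wEta i ε (z, s) (z', s) * |trDif b gS (z, s) (z', s) lam| ≤
      (1 + cR39 b) * (PairT (R₀ := R₀) (H₀ := H₀) i b gS ε y' lam + ((ℓ + 1 : ℕ) : ℝ) * (Wscl i p y' * SupZ (R := R₀) (H := H₀) i y' lam)) := by
  classical
  have hL0 : (0 : ℝ) ≤ ((ℓ + 1 : ℕ) : ℝ) := Nat.cast_nonneg _
  have hW := Wscl_nonneg i p y'
  have hS := SupZ_nonneg (R := R₀) (H := H₀) (i := i) y' lam
  have hP := PairT_nonneg (R₀ := R₀) (H₀ := H₀) (b := b) (gS := gS) (ε := ε) (i := i) y' lam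
  have hcR := cR39_nonneg b
  have hcb : 0 ≤ coordBound39 b := norm_nonneg _
  have hbb : 0 ≤ basisBound39 b := Finset.sum_nonneg fun _ _ => norm_nonneg _
  have hw0 : 0 ≤ wEta i ε (z, s) (z', s) := wEta_nonneg i ε _ _
  have hD : 0 < torusSupNorm (toKT i).NB (z.1 - z'.1) := lt_of_lt_of_le one_pos (one_le_torusSupNorm_sub (toKT i) (x := z') (x' := z) hne)
  have hn : (0 : ℝ) < (nKT (toKT i) : ℝ) := by exact_mod_cast lt_of_lt_of_le Nat.zero_lt_one (one_le_nKT (toKT i))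
  have hC1 : 1 ≤ 1 + cR39 b := le_add_of_nonneg_right hcR
  have hrest : 0 ≤ (1 + cR39 b) * (PairT (R₀ := R₀) (H₀ := H₀) i b gS ε y' lam + ((ℓ + 1 : ℕ) : ℝ) * (Wscl i p y' * SupZ (R := R₀) (H := H₀) i y' lam)) := by positivity
  set Λ : SiteY i → 𝔸 := assembleK b s.1 s.2.2 lam with hΛ
  -- symmetric form of the weight
  have hwsymm : wEta i ε (z', s) (z, s) = wEta i ε (z, s) (z', s) := by
    simp only [wEta]
    rw [show z'.1 - z.1 = -(z.1 - z'.1) by abel, B6Geom246MultiLevelTorus.torusSupNorm_neg (fun μ => one_le_N0 (toKT i).hMh (toKT i).hP μ)]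
  -- the far-pair weight bound
  have hfar : ∀ {w : SiteY i}, NearY i y' w → (((ℓ + 1 : ℕ) : ℝ)) ^ levY i w < torusSupNorm (toKT i).NB (z.1 - z'.1) →
      wEta i ε (z, s) (z', s) ≤ ((ℓ + 1 : ℕ) : ℝ) * Wscl i p y' := by
    intro w hw hlt
    have hwin := (levY_window_of_nearY i hw).1
    have hm : (0 : ℝ) < (((ℓ + 1 : ℕ) : ℝ)) ^ levY i w / (nKT (toKT i) : ℝ) := by positivity
    have hle : (((((ℓ + 1 : ℕ) : ℝ)) ^ levY i w / (nKT (toKT i) : ℝ)) ^ ε) ≤ (torusSupNorm (toKT i).NB (z.1 - z'.1) / (nKT (toKT i) : ℝ)) ^ ε :=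
      Real.rpow_le_rpow hm.le (div_le_div_of_nonneg_right hlt.le hn.le) hε0
    calc wEta i ε (z, s) (z', s) ≤ (((((ℓ + 1 : ℕ) : ℝ)) ^ levY i w / (nKT (toKT i) : ℝ)) ^ ε)⁻¹ := inv_anti₀ (Real.rpow_pos_of_pos hm _) hle
      _ ≤ (((ℓ + 1 : ℕ) : ℝ)) ^ 1 * Wscl i p y' := pow_weight_le_Wscl i hε0 hε1 hεp (by omega)
      _ = _ := by rw [pow_one]
  -- norms of the slice values
  have hΛz' : ‖Λ z'‖ ≤ basisBound39 b * ((Fintype.card κ : ℝ) * SupZ (R := R₀) (H := H₀) i y' lam) :=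
    (norm_assembleK_le b s.1 s.2.2 lam z').trans (mul_le_mul_of_nonneg_left (sum_abs_le_card_SupZ (R := R₀) (H := H₀) hloc z' s.1 s.2.2) hbb)
  -- the generic value bound `|trDif| ≤ |λ(z,s)| + cR39·SupZ`
  have hval : |trDif b gS (z, s) (z', s) lam| ≤ |lam (z, s)| + cR39 b * SupZ (R := R₀) (H := H₀) i y' lam := by
    rw [trDif_apply, map_sub, Finsupp.sub_apply, Node00.OpsYSectDCoords.repr_assembleK]
    refine (abs_sub _ _).trans (add_le_add le_rfl ?_)
    calc |b.repr (R (gS z z') (Λ z')) s.2.1| ≤ coordBound39 b * ‖R (gS z z') (Λ z')‖ := abs_repr_le b _ _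
      _ ≤ coordBound39 b * (basisBound39 b * ((Fintype.card κ : ℝ) * SupZ (R := R₀) (H := H₀) i y' lam)) :=
          mul_le_mul_of_nonneg_left ((hgS z z' _).trans hΛz') hcb
      _ = cR39 b * SupZ (R := R₀) (H := H₀) i y' lam := by simp only [cR39]; ring
  have hval' : |trDif b gS (z, s) (z', s) lam| ≤ (1 + cR39 b) * SupZ (R := R₀) (H := H₀) i y' lam := by
    have h1 := abs_le_SupZ (R := R₀) (H := H₀) hloc (z, s)
    nlinarith [hval]
  by_cases hz : NearY i y' z
  · by_cases hclose : torusSupNorm (toKT i).NB (z.1 - z'.1) ≤ (((ℓ + 1 : ℕ) : ℝ)) ^ levY i z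
    · -- a near pair based at `z ∈ Δ̃(y′)`: a term of `PairT`
      have hP' : NearPair i (z, s) (z', s) := ⟨hne, hclose, rfl⟩
      have hterm := ofPairsT_term_le (g := toB6 (geo9K i) R₀ H₀) (fun (q : XSK κ i) (y : IBondY i) => NearY i y q.1) (NearPair i) (wEta i ε)
        (wEta_nonneg i ε) (trDif b gS) (show NearY i y' (z, s).1 from hz) hP' lam
      calc _ ≤ PairT (R₀ := R₀) (H₀ := H₀) i b gS ε y' lam := hterm
        _ ≤ (1 + cR39 b) * PairT (R₀ := R₀) (H₀ := H₀) i b gS ε y' lam := le_mul_of_one_le_left hP hC1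
        _ ≤ _ := by nlinarith [mul_nonneg hL0 (mul_nonneg hW hS)]
    · push Not at hclose
      calc wEta i ε (z, s) (z', s) * |trDif b gS (z, s) (z', s) lam|
          ≤ (((ℓ + 1 : ℕ) : ℝ) * Wscl i p y') * ((1 + cR39 b) * SupZ (R := R₀) (H := H₀) i y' lam) :=
            mul_le_mul (hfar hz hclose) hval' (abs_nonneg _) (mul_nonneg hL0 hW)
        _ = (1 + cR39 b) * (((ℓ + 1 : ℕ) : ℝ) * (Wscl i p y' * SupZ (R := R₀) (H := H₀) i y' lam)) := by ring
        _ ≤ _ := by nlinarith [mul_nonneg (add_nonneg zero_le_one hcR) hP]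
  · -- `z ∉ Δ̃(y′)`: `Λ(z) = 0`
    have hzero : ∀ a, lam (z, s.1, a, s.2.2) = 0 := fun a => hloc (z, s.1, a, s.2.2) hz
    have hΛz : Λ z = 0 := Finset.sum_eq_zero fun a _ => by rw [hzero a, zero_smul]
    by_cases hz' : NearY i y' z'
    · by_cases hclose : torusSupNorm (toKT i).NB (z'.1 - z.1) ≤ (((ℓ + 1 : ℕ) : ℝ)) ^ levY i z'
      · -- a near pair based at `z′ ∈ Δ̃(y′)`: the value is `−repr_c(R(g)Λ(z′))`, read through the `z′`-based terms `repr_a Λ(z′)` of `PairT`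
        have hP' : ∀ a, NearPair i (z', s.1, a, s.2.2) (z, s.1, a, s.2.2) := fun a => ⟨hne.symm, hclose, rfl⟩
        -- each coordinate of `Λ(z′)` IS a `z′`-based transported term (`Λ(z) = 0`)
        have hcoord : ∀ a, trDif b gS (z', s.1, a, s.2.2) (z, s.1, a, s.2.2) lam = lam (z', s.1, a, s.2.2) := fun a => by
          rw [trDif_apply]
          show b.repr (Λ z' - R (gS z' z) (Λ z)) a = _
          rw [hΛz, B9Eq39Adjoint.R_zero, sub_zero, hΛ, Node00.OpsYSectDCoords.repr_assembleK]
        have hsum : wEta i ε (z, s) (z', s) * ∑ a, |lam (z', s.1, a, s.2.2)| ≤ (Fintype.card κ : ℝ) * PairT (R₀ := R₀) (H₀ := H₀) i b gS ε y' lam := by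
          rw [Finset.mul_sum]
          calc ∑ a, wEta i ε (z, s) (z', s) * |lam (z', s.1, a, s.2.2)| ≤ ∑ _a : κ, PairT (R₀ := R₀) (H₀ := H₀) i b gS ε y' lam :=
                Finset.sum_le_sum fun a _ => by
                  rw [← hcoord a, ← hwsymm]
                  have hw' : wEta i ε (z', s) (z, s) = wEta i ε (z', s.1, a, s.2.2) (z, s.1, a, s.2.2) := rfl
                  rw [hw']
                  exact ofPairsT_term_le (g := toB6 (geo9K i) R₀ H₀) (fun (q : XSK κ i) (y : IBondY i) => NearY i y q.1) (NearPair i) (wEta i ε)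
                    (wEta_nonneg i ε) (trDif b gS) (show NearY i y' (z', s.1, a, s.2.2).1 from hz') (hP' a) lam
            _ = _ := by rw [Finset.sum_const, nsmul_eq_mul, Finset.card_univ]
        have hv : |trDif b gS (z, s) (z', s) lam| ≤ coordBound39 b * (basisBound39 b * ∑ a, |lam (z', s.1, a, s.2.2)|) := by
          rw [trDif_apply]
          show |b.repr (Λ z - R (gS z z') (Λ z')) s.2.1| ≤ _
          rw [hΛz, zero_sub, map_neg, Finsupp.neg_apply, abs_neg]
          exact (abs_repr_le b _ _).trans (mul_le_mul_of_nonneg_left ((hgS z z' _).trans (norm_assembleK_le b s.1 s.2.2 lam z')) hcb)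
        calc wEta i ε (z, s) (z', s) * |trDif b gS (z, s) (z', s) lam|
            ≤ wEta i ε (z, s) (z', s) * (coordBound39 b * (basisBound39 b * ∑ a, |lam (z', s.1, a, s.2.2)|)) := mul_le_mul_of_nonneg_left hv hw0
          _ = coordBound39 b * basisBound39 b * (wEta i ε (z, s) (z', s) * ∑ a, |lam (z', s.1, a, s.2.2)|) := by ring
          _ ≤ coordBound39 b * basisBound39 b * ((Fintype.card κ : ℝ) * PairT (R₀ := R₀) (H₀ := H₀) i b gS ε y' lam) :=
              mul_le_mul_of_nonneg_left hsum (mul_nonneg hcb hbb)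
          _ = cR39 b * PairT (R₀ := R₀) (H₀ := H₀) i b gS ε y' lam := by simp only [cR39]; ring
          _ ≤ _ := by nlinarith [mul_nonneg hL0 (mul_nonneg hW hS), mul_nonneg (add_nonneg zero_le_one hcR) (mul_nonneg hL0 (mul_nonneg hW hS))]
      · push Not at hclose
        rw [show z'.1 - z.1 = -(z.1 - z'.1) by abel, B6Geom246MultiLevelTorus.torusSupNorm_neg (fun μ => one_le_N0 (toKT i).hMh (toKT i).hP μ)] at hclose
        calc wEta i ε (z, s) (z', s) * |trDif b gS (z, s) (z', s) lam|
            ≤ (((ℓ + 1 : ℕ) : ℝ) * Wscl i p y') * ((1 + cR39 b) * SupZ (R := R₀) (H := H₀) i y' lam) :=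
              mul_le_mul (hfar hz' hclose) hval' (abs_nonneg _) (mul_nonneg hL0 hW)
          _ = (1 + cR39 b) * (((ℓ + 1 : ℕ) : ℝ) * (Wscl i p y' * SupZ (R := R₀) (H := H₀) i y' lam)) := by ring
          _ ≤ _ := by nlinarith [mul_nonneg (add_nonneg zero_le_one hcR) hP]
    · have hzero' : ∀ a, lam (z', s.1, a, s.2.2) = 0 := fun a => hloc (z', s.1, a, s.2.2) hz'
      rw [trDif_eq_zero_of_fibres gS (z, s) (z', s) hzero hzero', abs_zero, mul_zero]
      exact hrest

end Terms

/-! ## §2 ★★★ The letter between the transported classes, abstract transporter tables -/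

section Letter

variable [Fintype (geo9K i).Site]
variable (b : Module.Basis κ ℝ 𝔸) [FiniteDimensional ℝ 𝔸] (B : B9.Backgrounds) (cfg : B.Cfg → CfgY 𝔸 i)
variable {bI : FBondY i → IBondY i}

/-- ★★★ **THE KINEMATIC LETTER `J_μ(U)` BETWEEN THE TRANSPORTED SMOOTH-PARTITION HÖLDER CLASSES** `bHZT g_S ε p → bHZKT g_B ε p`, member-uniform constant, NO
small-gauge binder: `HasMaj (bHZT i b g_S hε0 hε1 hεp) (bHZKT i b g_B hε0 hε1 hεp) (J_μ(U₁)) (fun y y′ => cR39·CJT ℓ p ϑ_L·e^{δ·rZ}·e^{−δ·d(y,y′)})`, every `δ ≥ 0`, under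
1-faithful direction-blind `bI`, contracting links `hU`, a non-expanding site table `hgS`, the LADDER-DEFECT binder `hlad` between the two tables (for def-Y's taxicab
tables: the plaquettes of the strip, `hasMaj_JcoKH_taxi`) and the displayed enlargement radius `hN` (LAYER B).
[cite: Balaban1985BackgroundPropagators, (3.3) p.390 + (3.35) p.396 + (3.40) p.397 + (3.43)–(3.45) p.398 + p.398 L19; Balaban1984PropagatorsII, (2.51)–(2.54) p.232 + (2.137) p.247] -/
theorem hasMaj_JcoKH_transported {R₀ : ℝ} {H₀ : Prop} {ε p : ℝ} (hε0 : 0 ≤ ε) (hε1 : ε ≤ 1) (hεp : ε ≤ p)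
    (gS : SiteY i → SiteY i → 𝔸ˣ) (gB : FBondY i → FBondY i → 𝔸ˣ)
    (hβ1 : ∀ f : FBondY i, (geomT i.D).dist (β i.hN i.D i.hk (bI f)) (blkV1 i.hN i.D f) ≤ 1)
    (hbI0 : ∀ f : FBondY i, bI f = bI ⟨f.src, 0⟩) {U₁ : B.Cfg}
    (hU : ∀ (ν : Fin (d + 1)) (s : Site (PV d ℓ i.m i.K hd hL) 0), ‖(cfg U₁ ν s : 𝔸)‖ ≤ 1 ∧ ‖(((cfg U₁ ν s)⁻¹ : 𝔸ˣ) : 𝔸)‖ ≤ 1)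
    (hgS : ∀ (z z' : SiteY i) (Y : 𝔸), ‖R (gS z z') Y‖ ≤ ‖Y‖) {ϑL : ℝ} (hϑ : 0 ≤ ϑL) (μ : Fin (d + 1))
    (hlad : ∀ (s s' : Site (PV d ℓ i.m i.K hd hL) 0), Adm i ⟨s, μ⟩ ⟨s', μ⟩ → ∀ Y : 𝔸,
      ‖R ((cfg U₁ μ s)⁻¹ * gB ⟨s, μ⟩ ⟨s', μ⟩ * cfg U₁ μ s') Y - R (gS (chartY i (s.shift μ)) (chartY i (s'.shift μ))) Y‖ ≤ ϑL * tpar i ⟨s, μ⟩ ⟨s', μ⟩ * ‖Y‖)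
    {r : ℝ} (hN : ∀ (y : IBondY i) (z : SiteY i), NearY i y z → (geo9K i).dist y (sIK i bI z) ≤ r) {δ : ℝ} (hδ : 0 ≤ δ) :
    HasMaj (bHZT (κ := κ) i b gS (R := R₀) (H := H₀) hε0 hε1 hεp) (bHZKT (κ := κ) i b gB (R := R₀) (H := H₀) hε0 hε1 hεp) (JcoKH i b B cfg μ U₁)
      (fun y y' => cR39 b * CJT b ℓ p ϑL * Real.exp (δ * rZ d ℓ r) * Real.exp (-(δ * (geo9K i).dist y y'))) := by
  classical
  intro y' lam hloc y
  rw [bHZT_isLoc_iff] at hloc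
  set J := JcoKH i b B cfg μ U₁ with hJ
  set S : ℝ := SupZ (R := R₀) (H := H₀) i y' lam with hSdef
  set P : ℝ := PairT (R₀ := R₀) (H₀ := H₀) i b gS ε y' lam with hPdef
  set W : ℝ := Wscl i p y' with hWdef
  have hp0 : 0 ≤ p := hε0.trans hεp
  have hL0 : (0 : ℝ) ≤ ((ℓ + 1 : ℕ) : ℝ) := Nat.cast_nonneg _
  have hL1 : (1 : ℝ) ≤ ((ℓ + 1 : ℕ) : ℝ) := by exact_mod_cast Nat.succ_le_succ (Nat.zero_le ℓ)
  have hS : 0 ≤ S := SupZ_nonneg (R := R₀) (H := H₀) (i := i) y' lam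
  have hP : 0 ≤ P := PairT_nonneg (R₀ := R₀) (H₀ := H₀) (b := b) (gS := gS) (ε := ε) (i := i) y' lam
  have hW : 0 ≤ W := Wscl_nonneg i p y'
  have hcR := cR39_nonneg b
  have hcb : 0 ≤ coordBound39 b := norm_nonneg _
  have hbb : 0 ≤ basisBound39 b := Finset.sum_nonneg fun _ _ => norm_nonneg _
  have hC1 : 0 ≤ 1 + cR39 b := add_nonneg zero_le_one hcR
  have hloc' : (bHZT (κ := κ) i b gS (R := R₀) (H := H₀) hε0 hε1 hεp).loc y' lam = W * S + P := bHZT_loc_eq hε0 hε1 hεp y' lam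
  have hCJT : 0 ≤ CJT b ℓ p ϑL := CJT_nonneg hϑ
  have hK0 : 0 ≤ cR39 b * CJT b ℓ p ϑL * Real.exp (δ * rZ d ℓ r) * Real.exp (-(δ * (geo9K i).dist y y')) := by positivity
  rw [bHZKT_loc, hloc']
  -- the pair-term constant
  set CP : ℝ := (1 + cR39 b) * (((ℓ + 1 : ℕ) : ℝ) + 1) + ϑL * (((ℓ + 1 : ℕ) : ℝ)) ^ 3 with hCPdef
  have hCP : 0 ≤ CP := by positivity
  -- THE PAIR TERM, uniformly on near bond pairs
  have hpair : ∀ q q' : XBK κ i, NearPairK i q q' →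
      wEtaK i ε q q' * |trDif b gB q q' (J lam)| ≤ cR39 b * ((1 + cR39 b) * P + CP * (W * S)) := by
    intro q q' hqq
    obtain ⟨⟨x, dq⟩, s⟩ := q
    obtain ⟨⟨x', dq'⟩, s'⟩ := q'
    have hbound0 : 0 ≤ cR39 b * ((1 + cR39 b) * P + CP * (W * S)) := by positivity
    have hdir : dq = dq' := hqq.2.1.1
    have hs : s = s' := hqq.2.2
    cases hs
    by_cases hμ : dq = μ
    swap
    · -- other directions: `J_μλ` vanishes on both fibres
      rw [trDif_eq_zero_of_fibres gB ((⟨x, dq⟩ : FBondY i), s) ((⟨x', dq'⟩ : FBondY i), s)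
        (fun a => JcoKH_apply_of_dir_ne i b B cfg μ U₁ lam (p := (⟨x, dq⟩, s.1, a, s.2.2)) hμ)
        (fun a => JcoKH_apply_of_dir_ne i b B cfg μ U₁ lam (p := (⟨x', dq'⟩, s.1, a, s.2.2)) (by rw [← hdir]; exact hμ)), abs_zero, mul_zero]
      exact hbound0
    cases hdir
    have hμ' : μ = dq := hμ.symm
    cases hμ'
    have hxne : x ≠ x' := src_ne_of_nearPairK i hqq
    have hadm : Adm i ⟨x, μ⟩ ⟨x', μ⟩ := hqq.2.1
    set z : SiteY i := chartY i (x.shift μ) with hz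
    set z' : SiteY i := chartY i (x'.shift μ) with hz'
    set Λ : SiteY i → 𝔸 := assembleK b s.1 s.2.2 lam with hΛ
    have hzne : z.1 ≠ z'.1 := by
      intro he
      have : z = z' := Subtype.ext he
      exact hxne (shift_injective' i ((chartY i).injective this))
    -- the weight of the bond pair IS the site weight of the shifted pair
    have hwz : wEtaK i ε (⟨x, μ⟩, s) (⟨x', μ⟩, s) = wEta i ε (z, s) (z', s) := by
      rw [wEtaK, wEta]
      show (((supDist x x' : ℝ) / (nKT (toKT i) : ℝ)) ^ ε)⁻¹ = _
      rw [← B6Grad2LegLettersKLevelV1.supDist_shift x x' μ, ← torusSupNorm_chartY_sub]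
    have hsd : (0 : ℝ) < (supDist x x' : ℝ) := by
      have h0 : supDist x x' ≠ 0 := fun h => hxne ((B3TorusRadialSums.supDist_eq_zero_iff x x').1 h)
      exact_mod_cast Nat.pos_of_ne_zero h0
    have hn : (0 : ℝ) < (nKT (toKT i) : ℝ) := by exact_mod_cast lt_of_lt_of_le Nat.zero_lt_one (one_le_nKT (toKT i))
    have hlx : (blkV1 i.hN i.D (⟨x, μ⟩ : FBondY i)).1.1 = levY i (chartY i x) := blkV1_level_eq_levY i (⟨x, μ⟩, s)
    have hwt : wEtaK i ε (⟨x, μ⟩, s) (⟨x', μ⟩, s) =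
        tpar i ⟨x, μ⟩ ⟨x', μ⟩ ^ (-ε) * (((((ℓ + 1 : ℕ) : ℝ)) ^ levY i (chartY i x) / (nKT (toKT i) : ℝ)) ^ ε)⁻¹ := by
      rw [wEtaK, tpar_eq, hlx, Real.rpow_neg (by positivity), ← mul_inv, ← Real.mul_rpow (by positivity) (by positivity)]
      congr 2
      show (supDist x x' : ℝ) / (nKT (toKT i) : ℝ) = _
      field_simp
    have htp : 0 < tpar i ⟨x, μ⟩ ⟨x', μ⟩ := by
      rw [tpar_eq, hlx]; positivity
    have htp1 : tpar i ⟨x, μ⟩ ⟨x', μ⟩ ≤ 1 := tpar_le_one i hadm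
    -- the value of the transported difference of `J_μλ`
    have hval : trDif b gB ((⟨x, μ⟩ : FBondY i), s) ((⟨x', μ⟩ : FBondY i), s) (J lam) =
        -(b.repr (R (cfg U₁ μ x) (Λ z - R ((cfg U₁ μ x)⁻¹ * gB ⟨x, μ⟩ ⟨x', μ⟩ * cfg U₁ μ x') (Λ z'))) s.2.1) := by
      rw [trDif_apply, assembleK_JcoKH, assembleK_JcoKH, Jb_apply, Jb_apply, if_pos rfl, if_pos rfl]
      show b.repr (-R (cfg U₁ μ x) (Λ z) - R (gB ⟨x, μ⟩ ⟨x', μ⟩) (-R (cfg U₁ μ x') (Λ z'))) s.2.1 = _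
      have hneg : ∀ (u : 𝔸ˣ) (Y : 𝔸), R u (-Y) = -R u Y := fun u Y => by
        rw [eq_neg_iff_add_eq_zero, ← B9Eq39Adjoint.R_add, neg_add_cancel, B9Eq39Adjoint.R_zero]
      have e : -R (cfg U₁ μ x) (Λ z) - R (gB ⟨x, μ⟩ ⟨x', μ⟩) (-R (cfg U₁ μ x') (Λ z')) =
          -(R (cfg U₁ μ x) (Λ z - R ((cfg U₁ μ x)⁻¹ * gB ⟨x, μ⟩ ⟨x', μ⟩ * cfg U₁ μ x') (Λ z'))) := by
        rw [hneg, sub_neg_eq_add, B9Eq39Adjoint.R_sub, B9Eq39Adjoint.R_mul, B9Eq39Adjoint.R_mul, B9Eq39Adjoint.R_R_inv]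
        abel
      rw [e, map_neg, Finsupp.neg_apply]
    -- split `Λz − R(W)Λz′` into the site-class difference and the ladder defect
    have hsplit : Λ z - R ((cfg U₁ μ x)⁻¹ * gB ⟨x, μ⟩ ⟨x', μ⟩ * cfg U₁ μ x') (Λ z') =
        (Λ z - R (gS z z') (Λ z')) + (R (gS z z') (Λ z') - R ((cfg U₁ μ x)⁻¹ * gB ⟨x, μ⟩ ⟨x', μ⟩ * cfg U₁ μ x') (Λ z')) := by abel
    have hΛz' : ‖Λ z'‖ ≤ basisBound39 b * ((Fintype.card κ : ℝ) * S) :=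
      (norm_assembleK_le b s.1 s.2.2 lam z').trans (mul_le_mul_of_nonneg_left (sum_abs_le_card_SupZ (R := R₀) (H := H₀) hloc z' s.1 s.2.2) hbb)
    -- the site-class difference term
    have hdiff : wEtaK i ε (⟨x, μ⟩, s) (⟨x', μ⟩, s) * ‖Λ z - R (gS z z') (Λ z')‖ ≤
        basisBound39 b * ((Fintype.card κ : ℝ) * ((1 + cR39 b) * (P + ((ℓ + 1 : ℕ) : ℝ) * (W * S)))) := by
      rw [hwz, assembleK_sub_R_eq_sum]
      refine (mul_le_mul_of_nonneg_left (norm_sum_smul_basis_le b _) (wEta_nonneg i ε _ _)).trans ?_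
      rw [mul_left_comm, Finset.mul_sum]
      refine mul_le_mul_of_nonneg_left ?_ hbb
      calc ∑ a, wEta i ε (z, s) (z', s) * |trDif b gS (z, s.1, a, s.2.2) (z', s.1, a, s.2.2) lam|
          ≤ ∑ _a : κ, (1 + cR39 b) * (P + ((ℓ + 1 : ℕ) : ℝ) * (W * S)) := Finset.sum_le_sum fun a _ => by
            have h := weight_mul_abs_trDif_le (b := b) (R₀ := R₀) (H₀ := H₀) hε0 hε1 hεp hgS hloc hzne (s.1, a, s.2.2)
            have hw' : wEta i ε (z, s.1, a, s.2.2) (z', s.1, a, s.2.2) = wEta i ε (z, s) (z', s) := rfl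
            rw [hw'] at h
            exact h
        _ = _ := by rw [Finset.sum_const, nsmul_eq_mul, Finset.card_univ]
    -- the ladder-defect term
    have hladder : wEtaK i ε (⟨x, μ⟩, s) (⟨x', μ⟩, s) *
        ‖R (gS z z') (Λ z') - R ((cfg U₁ μ x)⁻¹ * gB ⟨x, μ⟩ ⟨x', μ⟩ * cfg U₁ μ x') (Λ z')‖ ≤
        ϑL * (((ℓ + 1 : ℕ) : ℝ)) ^ 3 * W * (basisBound39 b * ((Fintype.card κ : ℝ) * S)) := by
      by_cases hsum : ∑ a, |lam (z', s.1, a, s.2.2)| = 0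
      · have hΛ0 : Λ z' = 0 := Finset.sum_eq_zero fun a _ => by
          rw [(abs_eq_zero.1 (le_antisymm ((Finset.single_le_sum (fun a _ => abs_nonneg (lam (z', s.1, a, s.2.2))) (Finset.mem_univ a)).trans
            hsum.le) (abs_nonneg _))), zero_smul]
        rw [hΛ0, B9Eq39Adjoint.R_zero, B9Eq39Adjoint.R_zero, sub_zero, norm_zero, mul_zero]; positivity
      · -- some `λ(z′, ·) ≠ 0`: `z′ ∈ Δ̃(y′)`, so `j(y′) ≤ lev x + 3`
        have hza : ∃ a, lam (z', s.1, a, s.2.2) ≠ 0 := by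
          by_contra hall
          push Not at hall
          exact hsum (Finset.sum_eq_zero fun a _ => by rw [hall a, abs_zero])
        obtain ⟨a, ha⟩ := hza
        have hzN : NearY i y' z' := by by_contra hnn; exact ha (hloc (z', s.1, a, s.2.2) hnn)
        have hlz := (levY_window_of_nearY i hzN).1
        have hlxz := (levY_src_read i μ ((⟨x', μ⟩ : FBondY i), s)).2
        -- `lev(chart x′) ≤ lev(chart x) + 1` from admissibility
        have hxx : levY i (chartY i x') ≤ levY i (chartY i x) + 1 := by
          have hdle : torusSupNorm (toKT i).NB ((chartY i x').1 - (chartY i x).1) ≤ 6 * (((ℓ + 1 : ℕ) : ℝ)) ^ levY i (chartY i x) := by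
            rw [torusSupNorm_chartY_sub, B3TorusRadialSums.supDist_comm]
            have h1 : ((supDist x x' : ℕ) : ℝ) ≤ (((ℓ + 1 : ℕ) : ℝ)) ^ levY i (chartY i x) := by rw [← hlx]; exact_mod_cast hadm.2.1
            have h2 : (0 : ℝ) ≤ (((ℓ + 1 : ℕ) : ℝ)) ^ levY i (chartY i x) := by positivity
            linarith
          exact (levY_window i hdle).2
        have hwle : (((((ℓ + 1 : ℕ) : ℝ)) ^ levY i (chartY i x) / (nKT (toKT i) : ℝ)) ^ ε)⁻¹ ≤ (((ℓ + 1 : ℕ) : ℝ)) ^ 3 * W :=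
          pow_weight_le_Wscl i hε0 hε1 hεp (m := levY i (chartY i x)) (k := 3) (by
            have e1 : srcY i ((⟨x', μ⟩ : FBondY i), s) = chartY i x' := rfl
            have e2 : readZ i μ ((⟨x', μ⟩ : FBondY i), s) = z' := rfl
            rw [e1, e2] at hlxz
            omega)
        have hL := hlad x x' hadm (Λ z')
        rw [norm_sub_rev] at hL
        rw [hwt]
        have ht0 : 0 ≤ tpar i ⟨x, μ⟩ ⟨x', μ⟩ ^ (-ε) := Real.rpow_nonneg (tpar_nonneg i _ _) _
        -- `t^{−ε}·t ≤ 1`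
        have htt : tpar i ⟨x, μ⟩ ⟨x', μ⟩ ^ (-ε) * tpar i ⟨x, μ⟩ ⟨x', μ⟩ ≤ 1 := by
          rw [Real.rpow_neg htp.le]
          have h1 : tpar i ⟨x, μ⟩ ⟨x', μ⟩ ≤ tpar i ⟨x, μ⟩ ⟨x', μ⟩ ^ ε := by
            conv_lhs => rw [← Real.rpow_one (tpar i ⟨x, μ⟩ ⟨x', μ⟩)]
            exact Real.rpow_le_rpow_of_exponent_ge htp htp1 hε1
          rw [inv_mul_le_iff₀ (Real.rpow_pos_of_pos htp ε), mul_one]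
          exact h1
        calc tpar i ⟨x, μ⟩ ⟨x', μ⟩ ^ (-ε) * (((((ℓ + 1 : ℕ) : ℝ)) ^ levY i (chartY i x) / (nKT (toKT i) : ℝ)) ^ ε)⁻¹ *
              ‖R (gS z z') (Λ z') - R ((cfg U₁ μ x)⁻¹ * gB ⟨x, μ⟩ ⟨x', μ⟩ * cfg U₁ μ x') (Λ z')‖
            ≤ tpar i ⟨x, μ⟩ ⟨x', μ⟩ ^ (-ε) * (((((ℓ + 1 : ℕ) : ℝ)) ^ levY i (chartY i x) / (nKT (toKT i) : ℝ)) ^ ε)⁻¹ *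
                (ϑL * tpar i ⟨x, μ⟩ ⟨x', μ⟩ * ‖Λ z'‖) := mul_le_mul_of_nonneg_left hL (by positivity)
          _ = (tpar i ⟨x, μ⟩ ⟨x', μ⟩ ^ (-ε) * tpar i ⟨x, μ⟩ ⟨x', μ⟩) * (((((ℓ + 1 : ℕ) : ℝ)) ^ levY i (chartY i x) / (nKT (toKT i) : ℝ)) ^ ε)⁻¹ *
                (ϑL * ‖Λ z'‖) := by ring
          _ ≤ 1 * ((((ℓ + 1 : ℕ) : ℝ)) ^ 3 * W) * (ϑL * (basisBound39 b * ((Fintype.card κ : ℝ) * S))) := by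
              refine mul_le_mul (mul_le_mul htt hwle (by positivity) zero_le_one) (mul_le_mul_of_nonneg_left hΛz' hϑ) (by positivity) (by positivity)
          _ = _ := by ring
    -- assemble the pair term
    have hw0 : 0 ≤ wEtaK i ε (⟨x, μ⟩, s) (⟨x', μ⟩, s) := wEtaK_nonneg i ε _ _
    have habs : |trDif b gB ((⟨x, μ⟩ : FBondY i), s) ((⟨x', μ⟩ : FBondY i), s) (J lam)| ≤
        coordBound39 b * (‖Λ z - R (gS z z') (Λ z')‖ + ‖R (gS z z') (Λ z') - R ((cfg U₁ μ x)⁻¹ * gB ⟨x, μ⟩ ⟨x', μ⟩ * cfg U₁ μ x') (Λ z')‖) := by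
      rw [hval, abs_neg]
      refine (abs_repr_le b _ _).trans (mul_le_mul_of_nonneg_left ((norm_R_le (hU μ x) _).trans ?_) hcb)
      rw [hsplit]; exact norm_add_le _ _
    calc wEtaK i ε (⟨x, μ⟩, s) (⟨x', μ⟩, s) * |trDif b gB ((⟨x, μ⟩ : FBondY i), s) ((⟨x', μ⟩ : FBondY i), s) (J lam)|
        ≤ wEtaK i ε (⟨x, μ⟩, s) (⟨x', μ⟩, s) * (coordBound39 b *
            (‖Λ z - R (gS z z') (Λ z')‖ + ‖R (gS z z') (Λ z') - R ((cfg U₁ μ x)⁻¹ * gB ⟨x, μ⟩ ⟨x', μ⟩ * cfg U₁ μ x') (Λ z')‖)) :=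
          mul_le_mul_of_nonneg_left habs hw0
      _ = coordBound39 b * (wEtaK i ε (⟨x, μ⟩, s) (⟨x', μ⟩, s) * ‖Λ z - R (gS z z') (Λ z')‖ +
            wEtaK i ε (⟨x, μ⟩, s) (⟨x', μ⟩, s) * ‖R (gS z z') (Λ z') - R ((cfg U₁ μ x)⁻¹ * gB ⟨x, μ⟩ ⟨x', μ⟩ * cfg U₁ μ x') (Λ z')‖) := by ring
      _ ≤ coordBound39 b * (basisBound39 b * ((Fintype.card κ : ℝ) * ((1 + cR39 b) * (P + ((ℓ + 1 : ℕ) : ℝ) * (W * S)))) +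
            ϑL * (((ℓ + 1 : ℕ) : ℝ)) ^ 3 * W * (basisBound39 b * ((Fintype.card κ : ℝ) * S))) :=
          mul_le_mul_of_nonneg_left (add_le_add hdiff hladder) hcb
      _ = cR39 b * ((1 + cR39 b) * P + ((1 + cR39 b) * ((ℓ + 1 : ℕ) : ℝ) + ϑL * (((ℓ + 1 : ℕ) : ℝ)) ^ 3) * (W * S)) := by simp only [cR39]; ring
      _ ≤ cR39 b * ((1 + cR39 b) * P + CP * (W * S)) := by
          refine mul_le_mul_of_nonneg_left (add_le_add le_rfl (mul_le_mul_of_nonneg_right ?_ (mul_nonneg hW hS))) hcR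
          have hexp : CP = (1 + cR39 b) * ((ℓ + 1 : ℕ) : ℝ) + ϑL * (((ℓ + 1 : ℕ) : ℝ)) ^ 3 + (1 + cR39 b) := by rw [hCPdef]; ring
          rw [hexp]; linarith
  -- THE CASE SPLIT: is anything seen from `Δ̃(y)`?
  by_cases hseen : ∃ q q' : XBK κ i, NearY i y (srcY i q) ∧ (q' = q ∨ NearPairK i q q') ∧ NearY i y' (readZ i μ q')
  · obtain ⟨q₀, q₁, hq₀, hq₀₁, hq₁⟩ := hseen
    obtain ⟨hdist, hlvl⟩ := dist_lvl_of_seen i hβ1 hbI0 hN μ hq₀ hq₀₁ hq₁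
    have hexp : 1 ≤ Real.exp (δ * rZ d ℓ r) * Real.exp (-(δ * (geo9K i).dist y y')) := by
      rw [← Real.exp_add]; exact Real.one_le_exp (by nlinarith)
    have hWy : Wscl i p y ≤ (((ℓ + 1 : ℕ) : ℝ)) ^ ((4 : ℝ) * p) * W := by
      have h := Wscl_le_of_lvl_le i hp0 (k := 4) hlvl
      simp only [Nat.cast_ofNat] at h
      exact h
    -- sup part
    have hsup : Wscl i p y * (Size.ofSup (toB6 (geo9K i) R₀ H₀) (fun (q : XBK κ i) (y : IBondY i) => NearY i y (srcY i q))).sz y (J lam) ≤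
        (((ℓ + 1 : ℕ) : ℝ)) ^ ((4 : ℝ) * p) * cR39 b * (W * S) := by
      have h1 : (Size.ofSup (toB6 (geo9K i) R₀ H₀) (fun (q : XBK κ i) (y : IBondY i) => NearY i y (srcY i q))).sz y (J lam) ≤ cR39 b * S :=
        ofSup_sz_le _ (mul_nonneg hcR hS) fun q _ => abs_J_le_SupZ (R := R₀) (H := H₀) μ U₁ hU hloc q
      calc Wscl i p y * _ ≤ ((((ℓ + 1 : ℕ) : ℝ)) ^ ((4 : ℝ) * p) * W) * (cR39 b * S) := mul_le_mul hWy h1 (Size.nonneg _ _ _) (by positivity)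
        _ = _ := by ring
    -- pair part
    have hprs : (Size.ofPairsT (toB6 (geo9K i) R₀ H₀) (fun (q : XBK κ i) (y : IBondY i) => NearY i y (srcY i q)) (NearPairK i) (wEtaK i ε)
          (wEtaK_nonneg i ε) (trDif b gB)).sz y (J lam) ≤ cR39 b * ((1 + cR39 b) * P + CP * (W * S)) :=
      ofPairsT_sz_le _ _ _ _ _ (by positivity) fun q q' _ hqq => hpair q q' hqq
    calc _ ≤ (((ℓ + 1 : ℕ) : ℝ)) ^ ((4 : ℝ) * p) * cR39 b * (W * S) + cR39 b * ((1 + cR39 b) * P + CP * (W * S)) := add_le_add hsup hprs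
      _ ≤ cR39 b * CJT b ℓ p ϑL * (W * S + P) := by
          have hCJT_eq : CJT b ℓ p ϑL = (((ℓ + 1 : ℕ) : ℝ)) ^ ((4 : ℝ) * p) + CP := by rw [hCPdef]; unfold CJT; ring
          have hC1le : 1 + cR39 b ≤ CJT b ℓ p ϑL := by
            have h4 : 0 ≤ (((ℓ + 1 : ℕ) : ℝ)) ^ ((4 : ℝ) * p) := Real.rpow_nonneg hL0 _
            have hexp : CP = (1 + cR39 b) * ((ℓ + 1 : ℕ) : ℝ) + ϑL * (((ℓ + 1 : ℕ) : ℝ)) ^ 3 + (1 + cR39 b) := by rw [hCPdef]; ring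
            rw [hCJT_eq, hexp]
            nlinarith [mul_nonneg hC1 hL0, mul_nonneg hϑ (pow_nonneg hL0 3)]
          calc (((ℓ + 1 : ℕ) : ℝ)) ^ ((4 : ℝ) * p) * cR39 b * (W * S) + cR39 b * ((1 + cR39 b) * P + CP * (W * S))
              = cR39 b * (((((ℓ + 1 : ℕ) : ℝ)) ^ ((4 : ℝ) * p) + CP) * (W * S) + (1 + cR39 b) * P) := by ring
            _ ≤ cR39 b * (CJT b ℓ p ϑL * (W * S) + CJT b ℓ p ϑL * P) :=
                mul_le_mul_of_nonneg_left (add_le_add (by rw [hCJT_eq]) (mul_le_mul_of_nonneg_right hC1le hP)) hcR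
            _ = _ := by ring
      _ ≤ cR39 b * CJT b ℓ p ϑL * (Real.exp (δ * rZ d ℓ r) * Real.exp (-(δ * (geo9K i).dist y y'))) * (W * S + P) :=
          mul_le_mul_of_nonneg_right (le_mul_of_one_le_right (mul_nonneg hcR hCJT) hexp) (by positivity)
      _ = _ := by ring
  · -- nothing of `λ` is seen from `Δ̃(y)`: the local size vanishes
    push Not at hseen
    have hval0 : ∀ q : XBK κ i, NearY i y (srcY i q) → J lam q = 0 := by
      intro q hq
      by_contra hne
      exact hseen q q hq (Or.inl rfl) (nearY_read_of_J_ne_zero μ U₁ hU hloc hne)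
    have hval0' : ∀ q q' : XBK κ i, NearY i y (srcY i q) → NearPairK i q q' → J lam q' = 0 := by
      intro q q' hq hqq
      by_contra hne
      exact hseen q q' hq (Or.inr hqq) (nearY_read_of_J_ne_zero μ U₁ hU hloc hne)
    have hsup : (Size.ofSup (toB6 (geo9K i) R₀ H₀) (fun (q : XBK κ i) (y : IBondY i) => NearY i y (srcY i q))).sz y (J lam) ≤ 0 :=
      ofSup_sz_le _ le_rfl fun q hq => by rw [hval0 q hq, abs_zero]
    have hprs : (Size.ofPairsT (toB6 (geo9K i) R₀ H₀) (fun (q : XBK κ i) (y : IBondY i) => NearY i y (srcY i q)) (NearPairK i) (wEtaK i ε)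
          (wEtaK_nonneg i ε) (trDif b gB)).sz y (J lam) ≤ 0 :=
      ofPairsT_sz_le _ _ _ _ _ le_rfl fun q q' hq hqq => by
        have hsl : ∀ a, NearPairK i (q.1, q.2.1, a, q.2.2.2) (q'.1, q.2.1, a, q.2.2.2) := fun a => ⟨hqq.1, hqq.2.1, rfl⟩
        rw [trDif_eq_zero_of_fibres gB q q' (fun a => hval0 (q.1, q.2.1, a, q.2.2.2) hq)
          (fun a => hval0' (q.1, q.2.1, a, q.2.2.2) (q'.1, q.2.1, a, q.2.2.2) hq (hsl a)), abs_zero, mul_zero]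
    calc _ ≤ Wscl i p y * 0 + 0 := add_le_add (mul_le_mul_of_nonneg_left hsup (Wscl_nonneg i p y)) hprs
      _ = 0 := by ring
      _ ≤ _ := mul_nonneg hK0 (by positivity)

end Letter

/-! ## §3 ★★ At node00-def-Y's taxicab tables: the ladder binder discharged by a plaquette binder -/

section Taxi

variable [Fintype (geo9K i).Site]
variable (b : Module.Basis κ ℝ 𝔸) [FiniteDimensional ℝ 𝔸] (B : B9.Backgrounds) (cfg : B.Cfg → CfgY 𝔸 i)
variable {bI : FBondY i → IBondY i}

/-- the SITE taxicab table of a configuration read on the box chart (node00-def-Y's `parSY` at `cfg U₁`). [cite: Balaban1985BackgroundPropagators, (3.40) p.397, dictionary] -/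
def taxiS (U₁ : B.Cfg) : SiteY i → SiteY i → 𝔸ˣ := fun z z' => parTaxiV (cfg U₁) ((boxEquiv i.hN).symm z) ((boxEquiv i.hN).symm z')

/-- the BOND taxicab table of a configuration, sources transported (node00-def-Y's `parBY` at `cfg U₁`; the table of the certificate's probe pin `holderProbesKA`).
[cite: Balaban1985BackgroundPropagators, (3.40) p.397, dictionary] -/
def taxiB (U₁ : B.Cfg) : FBondY i → FBondY i → 𝔸ˣ := fun x x' => parTaxiV (cfg U₁) x.src x'.src

omit [Fintype (geo9K i).Site] in
/-- the level of a fine bond's block is the level of its charted source. [cite: Balaban1984PropagatorsII, (2.45) p.231, bookkeeping] -/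
theorem blkV1_level_eq_levY_src (x : FBondY i) : (blkV1 i.hN i.D x).1.1 = levY i (chartY i x.src) := by
  rw [B9MultiscaleSmoothPartitionY.levY_eq_blkOf]; rfl

omit [Fintype (geo9K i).Site] in
/-- **THE STRIP STAYS IN THE TWO-LEVEL WINDOW**: for an admissible pair `(s, s′)` and `y` with `|s + e_μ − y|_∞ ≤ |s − s′|_∞`, the plaquette corner `y − e_μ` has level
`≥ lev(s) − 2` (`y` lies within `L^{lev s} + 1 ≤ 6L^{lev s}` of `s`; the corner is adjacent to `y`). [cite: Balaban1984PropagatorsII, (2.2) p.224; Balaban1985BackgroundPropagators, (3.35) p.396] -/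
theorem lev_le_lev_strip {μ : Fin (d + 1)} {s s' : Site (PV d ℓ i.m i.K hd hL) 0} (hadm : Adm i ⟨s, μ⟩ ⟨s', μ⟩) {y : Site (PV d ℓ i.m i.K hd hL) 0}
    (hy : supDist (s.shift μ) y ≤ supDist s s') : levY i (chartY i s) ≤ levY i (chartY i (y.unshift μ)) + 2 := by
  have hL1 : (1 : ℝ) ≤ ((ℓ + 1 : ℕ) : ℝ) := by exact_mod_cast Nat.succ_le_succ (Nat.zero_le ℓ)
  have hpow : (1 : ℝ) ≤ (((ℓ + 1 : ℕ) : ℝ)) ^ levY i (chartY i s) := one_le_pow₀ hL1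
  -- `|y − s|_∞ ≤ |s − s′|_∞ + 1 ≤ L^{lev s} + 1`
  have hadm' : ((supDist s s' : ℕ) : ℝ) ≤ (((ℓ + 1 : ℕ) : ℝ)) ^ levY i (chartY i s) := by
    rw [← blkV1_level_eq_levY_src i ⟨s, μ⟩]; exact_mod_cast hadm.2.1
  have h1 : supDist y s ≤ supDist s s' + 1 :=
    calc supDist y s ≤ supDist y (s.shift μ) + supDist (s.shift μ) s := B3KernelConvolutionTorus.supDist_triangle' _ _ _
      _ ≤ supDist s s' + 1 := add_le_add (by rw [B3TorusRadialSums.supDist_comm]; exact hy)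
          (by rw [B3TorusRadialSums.supDist_comm]; exact B9GradViaDivLettersAtPins.supDist_shift_le_one i s μ)
  have hw1 : torusSupNorm (toKT i).NB ((chartY i y).1 - (chartY i s).1) ≤ 6 * (((ℓ + 1 : ℕ) : ℝ)) ^ levY i (chartY i s) := by
    rw [torusSupNorm_chartY_sub]
    have : ((supDist y s : ℕ) : ℝ) ≤ (supDist s s' : ℝ) + 1 := by exact_mod_cast h1
    linarith
  have hys := (levY_window i hw1).1
  -- the corner `y − e_μ` is adjacent to `y`
  have hw2 : torusSupNorm (toKT i).NB ((chartY i (y.unshift μ)).1 - (chartY i y).1) ≤ 6 * (((ℓ + 1 : ℕ) : ℝ)) ^ levY i (chartY i y) := by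
    rw [torusSupNorm_chartY_sub]
    have h2 : supDist (y.unshift μ) y ≤ 1 := by
      have := B9GradViaDivLettersAtPins.supDist_shift_le_one i (y.unshift μ) μ
      rwa [B9TaxiTransportLadder.shift_unshift'] at this
    have h2' : ((supDist (y.unshift μ) y : ℕ) : ℝ) ≤ 1 := by exact_mod_cast h2
    have : (1 : ℝ) ≤ (((ℓ + 1 : ℕ) : ℝ)) ^ levY i (chartY i y) := one_le_pow₀ hL1
    linarith
  have hyc := (levY_window i hw2).1
  omega

/-- ★★ **THE TRANSPORTED `J`-LETTER AT THE TAXICAB TABLES FROM A PLAQUETTE BINDER**: with `g_S := taxiS U₁`, `g_B := taxiB U₁` the ladder binder of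
`hasMaj_JcoKH_transported` is discharged by `B9TaxiTransportLadder.ladder_R_le` from the displayed, GAUGE-INVARIANT plaquette binder
`hF : ‖U(∂p_{y;μ′,ν′}) − 1‖ ≤ ϑ_F·(L^{lev y})⁻¹` (the content of (3.35) in any gauge), with `ϑ_L := 2·(d+1)·L²·ϑ_F`:
`HasMaj (bHZT i b (taxiS U₁) hε0 hε1 hεp) (bHZKT i b (taxiB U₁) hε0 hε1 hεp) (J_μ(U₁)) (cR39·CJT ℓ p ϑ_L·e^{δ·rZ}·e^{−δd})`.
[cite: Balaban1985BackgroundPropagators, (3.3) p.390 + (3.35) p.396 + (3.40) p.397 + (3.43)–(3.45) p.398 + p.398 L19; Balaban1984PropagatorsII, (2.51)–(2.54) p.232] -/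
theorem hasMaj_JcoKH_taxi {R₀ : ℝ} {H₀ : Prop} {ε p : ℝ} (hε0 : 0 ≤ ε) (hε1 : ε ≤ 1) (hεp : ε ≤ p)
    (hβ1 : ∀ f : FBondY i, (geomT i.D).dist (β i.hN i.D i.hk (bI f)) (blkV1 i.hN i.D f) ≤ 1)
    (hbI0 : ∀ f : FBondY i, bI f = bI ⟨f.src, 0⟩) {U₁ : B.Cfg}
    (hU : ∀ (ν : Fin (d + 1)) (s : Site (PV d ℓ i.m i.K hd hL) 0), ‖(cfg U₁ ν s : 𝔸)‖ ≤ 1 ∧ ‖(((cfg U₁ ν s)⁻¹ : 𝔸ˣ) : 𝔸)‖ ≤ 1)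
    {ϑF : ℝ} (hϑF : 0 ≤ ϑF)
    (hF : ∀ (y : Site (PV d ℓ i.m i.K hd hL) 0) (μ' ν' : Fin (d + 1)),
      ‖(plaqV (cfg U₁) y μ' ν' : 𝔸) - 1‖ ≤ ϑF * ((((ℓ + 1 : ℕ) : ℝ)) ^ levY i (chartY i y))⁻¹)
    {r : ℝ} (hN : ∀ (y : IBondY i) (z : SiteY i), NearY i y z → (geo9K i).dist y (sIK i bI z) ≤ r) {δ : ℝ} (hδ : 0 ≤ δ) (μ : Fin (d + 1)) :
    HasMaj (bHZT (κ := κ) i b (taxiS i B cfg U₁) (R := R₀) (H := H₀) hε0 hε1 hεp) (bHZKT (κ := κ) i b (taxiB i B cfg U₁) (R := R₀) (H := H₀) hε0 hε1 hεp)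
      (JcoKH i b B cfg μ U₁)
      (fun y y' => cR39 b * CJT b ℓ p (2 * ((d : ℝ) + 1) * (((ℓ + 1 : ℕ) : ℝ)) ^ 2 * ϑF) * Real.exp (δ * rZ d ℓ r) * Real.exp (-(δ * (geo9K i).dist y y'))) := by
  have hL0 : (0 : ℝ) ≤ ((ℓ + 1 : ℕ) : ℝ) := Nat.cast_nonneg _
  have hL1 : (1 : ℝ) ≤ ((ℓ + 1 : ℕ) : ℝ) := by exact_mod_cast Nat.succ_le_succ (Nat.zero_le ℓ)
  have hϑL : 0 ≤ 2 * ((d : ℝ) + 1) * (((ℓ + 1 : ℕ) : ℝ)) ^ 2 * ϑF := by positivity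
  refine hasMaj_JcoKH_transported i b B cfg hε0 hε1 hεp (taxiS i B cfg U₁) (taxiB i B cfg U₁) hβ1 hbI0 hU
    (fun z z' Y => norm_R_parTaxiV_le hU _ _ Y) hϑL μ ?_ hN hδ
  intro s s' hadm Y
  -- the ladder lemma on the strip, plaquette deviation `≤ ϑF·L²·(L^{lev s})⁻¹` there
  set θ : ℝ := ϑF * ((((ℓ + 1 : ℕ) : ℝ)) ^ 2 * ((((ℓ + 1 : ℕ) : ℝ)) ^ levY i (chartY i s))⁻¹) with hθdef
  have hθ0 : 0 ≤ θ := by positivity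
  have hθ : ∀ (ν : Fin (d + 1)) (y : Site (PV d ℓ i.m i.K hd hL) 0), supDist (s.shift μ) y ≤ supDist s s' →
      ‖(plaqV (cfg U₁) (y.unshift μ) μ ν : 𝔸) - 1‖ ≤ θ := by
    intro ν y hy
    refine (hF (y.unshift μ) μ ν).trans (mul_le_mul_of_nonneg_left ?_ hϑF)
    have hlev := lev_le_lev_strip i hadm hy
    have hpos : (0 : ℝ) < (((ℓ + 1 : ℕ) : ℝ)) ^ levY i (chartY i (y.unshift μ)) := by positivity
    have hpos' : (0 : ℝ) < (((ℓ + 1 : ℕ) : ℝ)) ^ levY i (chartY i s) := by positivity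
    have hpow : (((ℓ + 1 : ℕ) : ℝ)) ^ levY i (chartY i s) ≤ (((ℓ + 1 : ℕ) : ℝ)) ^ 2 * (((ℓ + 1 : ℕ) : ℝ)) ^ levY i (chartY i (y.unshift μ)) :=
      calc (((ℓ + 1 : ℕ) : ℝ)) ^ levY i (chartY i s) ≤ (((ℓ + 1 : ℕ) : ℝ)) ^ (levY i (chartY i (y.unshift μ)) + 2) := pow_le_pow_right₀ hL1 hlev
        _ = (((ℓ + 1 : ℕ) : ℝ)) ^ 2 * (((ℓ + 1 : ℕ) : ℝ)) ^ levY i (chartY i (y.unshift μ)) := by ring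
    rw [inv_le_iff_one_le_mul₀ hpos]
    calc (1 : ℝ) = (((ℓ + 1 : ℕ) : ℝ)) ^ levY i (chartY i s) * ((((ℓ + 1 : ℕ) : ℝ)) ^ levY i (chartY i s))⁻¹ := (mul_inv_cancel₀ hpos'.ne').symm
      _ ≤ ((((ℓ + 1 : ℕ) : ℝ)) ^ 2 * (((ℓ + 1 : ℕ) : ℝ)) ^ levY i (chartY i (y.unshift μ))) * ((((ℓ + 1 : ℕ) : ℝ)) ^ levY i (chartY i s))⁻¹ :=
          mul_le_mul_of_nonneg_right hpow (inv_nonneg.2 hpos'.le)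
      _ = _ := by ring
  have key := ladder_R_le (U := cfg U₁) hU hθ0 μ hθ Y
  -- rewrite the tables
  have hS' : taxiS i B cfg U₁ (chartY i (s.shift μ)) (chartY i (s'.shift μ)) = parTaxiV (cfg U₁) (s.shift μ) (s'.shift μ) := by
    show parTaxiV (cfg U₁) ((boxEquiv i.hN).symm (boxEquiv i.hN (s.shift μ))) ((boxEquiv i.hN).symm (boxEquiv i.hN (s'.shift μ))) = _
    rw [Equiv.symm_apply_apply, Equiv.symm_apply_apply]
  have hB' : taxiB i B cfg U₁ ⟨s, μ⟩ ⟨s', μ⟩ = parTaxiV (cfg U₁) s s' := rfl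
  rw [hS', hB']
  refine key.trans ?_
  -- `2·((d+1)·|s−s′|)·θ = ϑ_L·t(s,s′)` since `t = |s − s′|∕L^{lev s}`
  have hd : (((PV d ℓ i.m i.K hd hL).d : ℕ) : ℝ) = (d : ℝ) + 1 := by
    show (((d + 1 : ℕ)) : ℝ) = _; push_cast; ring
  rw [tpar_eq, blkV1_level_eq_levY_src, hd, hθdef]
  have hpos' : (0 : ℝ) < (((ℓ + 1 : ℕ) : ℝ)) ^ levY i (chartY i s) := by positivity
  apply le_of_eq
  rw [div_eq_mul_inv]
  ring

end Taxi

end Literature.MathematicalPhysics.QuantumFieldTheory.Balaban1983to89.B9GradViaDivLettersTransported
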